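import Literature.Computability.Complexity.ZPPOfExpectedTime
import Literature.Computability.Complexity.ClockedUniversalAcceptanceProofs
import Literature.Computability.Complexity.ProbabilisticClassesProofs
import Literature.Computability.Complexity.TruthTableClosure
import Literature.Computability.Complexity.ExpClosure
import Literature.Computability.Complexity.NPClosureProofs
import HarnessLib

/-!
# `ZPP = RP ∩ coRP` in machine form: a Las Vegas machine for `L ∈ RP ∩ coRP`, and the discharge
# of `mem_ZPP_iff_expectedTime`

Sibling proof file of `ProbabilisticClasses.lean` (D-0014), the sequel of `ZPPOfExpectedTime.lean`
(which proves the `←` direction of the named fact `mem_ZPP_iff_expectedTime` from the clocked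
universal acceptance test, since discharged as `clockedUniversalAcceptance_holds`). Here the `→`
direction — Gill 1977, Prop. 5.5(iii) [Rabin] "`L` is in `ZPP` iff both `L` and `L̄` are in `VPP`"
(proof omitted there: "We omit the easy proof"), Arora–Barak 2009, Thm. 7.8 `ZPP = RP ∩ coRP`
(proof left as Exercise 7.6) — is proved for the tree's model, and the fact is assembled:

* `mem_ZPP_iff_expectedTime_holds : mem_ZPP_iff_expectedTime`.

In the tree's model (`RandAlg.RunsInExpectedTime`, `Randomized.lean`) a zero-error machine has a
FIXED polynomial coin budget `q(n)` and must answer `[x ∈ L]` on EVERY coin string of that length,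
with the mean (over the `2^{q(n)}` coin strings) of a pointwise step bound at most `p(n)`. So the
textbook "repeat the `RP` and the `coRP` test until one of them is decisive" becomes: make `K(n)`
trials of each test and, on the at most `2^{-K(n)}` fraction of coin strings on which all trials are
indecisive, decide `x ∈ L` by exhaustive search (`RP ⊆ NP ⊆ EXP`), `K` being chosen so large that
the exponential cost times `2^{-K(n)}` is `≤ 1`. The machine is assembled WITHOUT programming, from
the tree's closure toolkit (approach: library-first):

* **amplified witnesses** `ZPPExpected.ampWitness L' p = {w | ∃ i < |w|, ⟨x, (r ↓ i) ↾ p(|x|)⟩ ∈ L' ∩ LenEq p}`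
  for `w = ⟨x, r⟩` (all windows of `r` of the exact length `p(|x|)`), in `P` by the bounded
  existential quantifier `bexLang_mem_P` (`TruthTableClosure.lean`) over the window map
  `ZPPExpected.coinWindowFn ∈ FP` (pair projections, `dropSndFn`, `truncSndFn`); if `x ∈ L` has
  acceptance probability `≥ 1/2` per block, the coin strings of length `K·p(|x|) + d` rejected by
  `ampWitness` number `≤ 2^{K p + d}/2^K` (product rule `cnt_take_drop` over the `K` disjoint
  blocks, `ZPPExpected.two_pow_mul_cnt_allBlocks_le`);
* **stage A** (`ZPPExpected.stageA ∈ FP`, a `P`-guarded conditional `condFn`): `⟨x, r⟩ ↦ [1]` if the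
  `RP` witness for `L` fires, `↦ []` if the one for `Lᶜ` fires, `↦ 0x` otherwise;
* **stage B**: the `2^{q₃(m)}`-time decider (`exists_two_pow_eval_of_mem_EXP`) of the residual
  language `ZPPExpected.residual L = decodeFn⁻¹(L) ∈ EXP`, where `decodeFn [1] = c₁ ∈ L`,
  `decodeFn [] = c₀ ∉ L` (classically chosen; these branches are only reached when `L`, resp. `Lᶜ`,
  is inhabited) and `decodeFn (0x) = x`; on the one- and zero-symbol words it runs `≤ 2^{q₃(1)}` steps;
* the composite machine `M_A.comp M_B` (`Turing.TM2ComputableAux.comp_outputsWithin`, additive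
  time) with `K(n) = q₃(n+1)`, coin budget `q = K·(p₁ + p₂)` and mean time
  `≤ p_A(2n + 2 + q(n)) + 2^{q₃(1)} + 1` (`ZPPExpected.mean_le_of_split`).

## References

* J. Gill, *Computational complexity of probabilistic Turing machines*, SIAM J. Comput. 6 (1977)
  675–695: Def. 5.1(iii) (p. 685, `ZPP` by average run time and zero error), Def. 5.4 (`VPP`),
  Prop. 5.5(iii) (p. 687, [Rabin] `ZPP = VPP ∩ co-VPP`, proof omitted). doi:10.1137/0206049
  [Gill1977]
* S. Arora, B. Barak, *Computational Complexity: A Modern Approach*, CUP 2009, Def. 7.7,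
  Thm. 7.8 (`ZPP = RP ∩ coRP`, Exercise 7.6), §7.4.1 (independent repetitions), Claim 2.4 /
  §2.6.2 (`NP ⊆ EXP` by exhaustive search). [AroraBarakCC2009]
-/

namespace Literature.Computability.Complexity

open _root_.Computability Turing Polynomial OracleCompose PRelSigma

namespace ZPPExpected

/-! ### Counting: all of `K` fresh coin blocks fail -/

/-- `AllBlocks ℓ R K`: the strings whose first `K` consecutive blocks of length `ℓ` all lie in `R`
(recursively: the prefix of length `ℓ` is in `R` and the rest is in `AllBlocks ℓ R (K-1)`).
[Arora–Barak 2009, §7.4.1 (independent repetitions)] [folklore] -/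
def AllBlocks (ℓ : ℕ) (R : Set (List Bool)) : ℕ → Set (List Bool)
  | 0 => Set.univ
  | K + 1 => {y | y.take ℓ ∈ R ∧ y.drop ℓ ∈ AllBlocks ℓ R K}

/-- A string all of whose `K` leading blocks lie in `R` is in `AllBlocks ℓ R K`. [folklore] -/
theorem mem_allBlocks_of_forall {ℓ : ℕ} {R : Set (List Bool)} :
    ∀ (K : ℕ) (y : List Bool), (∀ j < K, (y.drop (j * ℓ)).take ℓ ∈ R) → y ∈ AllBlocks ℓ R K
  | 0, y, _ => Set.mem_univ y
  | K + 1, y, h => by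
    refine ⟨by simpa using h 0 (Nat.succ_pos K), mem_allBlocks_of_forall K (y.drop ℓ) fun j hj => ?_⟩
    have h' := h (j + 1) (Nat.succ_lt_succ hj)
    have hdrop : (y.drop ℓ).drop (j * ℓ) = y.drop ((j + 1) * ℓ) := by
      rw [List.drop_drop]
      congr 1
      ring
    rwa [hdrop]

/-- **Product rule for `K` blocks**: `cnt (Kℓ + d) (AllBlocks ℓ R K) = (cnt ℓ R)^K · 2^d`
(iterate `cnt_take_drop`). [Arora–Barak 2009, §7.4.1] [folklore] -/
theorem cnt_allBlocks (ℓ d : ℕ) (R : Set (List Bool)) :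
    ∀ K : ℕ, cnt (K * ℓ + d) (AllBlocks ℓ R K) = cnt ℓ R ^ K * 2 ^ d
  | 0 => by
    rw [Nat.zero_mul, Nat.zero_add, pow_zero, one_mul]
    exact cnt_univ d
  | K + 1 => by
    rw [show (K + 1) * ℓ + d = ℓ + (K * ℓ + d) by ring]
    change cnt (ℓ + (K * ℓ + d)) {y | y.take ℓ ∈ R ∧ y.drop ℓ ∈ AllBlocks ℓ R K} = _
    rw [cnt_take_drop, cnt_allBlocks ℓ d R K]
    ring

/-- **All `K` trials fail with probability `≤ 2^{-K}`** (counting form): if at most half of the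
strings of length `ℓ` lie in `R`, then `2^K · cnt (Kℓ + d) (AllBlocks ℓ R K) ≤ 2^{Kℓ + d}`.
[Arora–Barak 2009, §7.4.1] [folklore] -/
theorem two_pow_mul_cnt_allBlocks_le {ℓ : ℕ} {R : Set (List Bool)} (hR : 2 * cnt ℓ R ≤ 2 ^ ℓ)
    (K d : ℕ) : 2 ^ K * cnt (K * ℓ + d) (AllBlocks ℓ R K) ≤ 2 ^ (K * ℓ + d) := by
  rw [cnt_allBlocks]
  calc 2 ^ K * (cnt ℓ R ^ K * 2 ^ d) = (2 * cnt ℓ R) ^ K * 2 ^ d := by rw [mul_pow]; ring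
    _ ≤ (2 ^ ℓ) ^ K * 2 ^ d := Nat.mul_le_mul_right _ (Nat.pow_le_pow_left hR K)
    _ = 2 ^ (K * ℓ + d) := by rw [pow_add, pow_mul']

/-- `1/2 ≤ uniformProb m E` as an integer inequality: `2^m ≤ 2 · cnt m E`. [folklore] -/
theorem two_pow_le_two_mul_cnt_of_half_le {m : ℕ} {E : Set (List Bool)}
    (h : 1 / 2 ≤ uniformProb m E) : 2 ^ m ≤ 2 * cnt m E := by
  rw [uniformProb_eq_cnt_div, le_div_iff₀ (by positivity)] at h
  have h' : ((2 ^ m : ℕ) : ℝ) ≤ ((2 * cnt m E : ℕ) : ℝ) := by push_cast; linarith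
  exact_mod_cast h'

/-- If at least half of the strings of length `m` lie in `E`, at most half lie outside.
[folklore] -/
theorem two_mul_cnt_compl_le {m : ℕ} {E : Set (List Bool)} (h : 1 / 2 ≤ uniformProb m E) :
    2 * cnt m Eᶜ ≤ 2 ^ m := by
  have h1 := two_pow_le_two_mul_cnt_of_half_le h
  have h2 := cnt_add_cnt_compl m E
  omega

/-- **Averaging a two-level step bound**: if `τ ≤ a + b` on all strings of length `m`, `τ ≤ a`
off the exceptional set `Ind`, and `#(Ind ∩ {0,1}^m) · b ≤ 2^m · c`, then the mean of `τ` over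
`{0,1}^m` is at most `a + c`. [Arora–Barak 2009, §7.4.2 (expected running time)] [folklore] -/
theorem mean_le_of_split {m : ℕ} (τ : List Bool → ℕ) (Ind : Set (List Bool)) (a b c : ℕ)
    (hall : ∀ r : List Bool, r.length = m → τ r ≤ a + b)
    (hgood : ∀ r : List Bool, r.length = m → r ∉ Ind → τ r ≤ a)
    (hcnt : cnt m Ind * b ≤ 2 ^ m * c) :
    (∑ r : List.Vector Bool m, (τ r.toList : ℝ)) / 2 ^ m ≤ ((a + c : ℕ) : ℝ) := by
  classical
  rw [div_le_iff₀ (by positivity)]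
  have key : ∀ r : List.Vector Bool m,
      (τ r.toList : ℝ) ≤ (a : ℝ) + (if r.toList ∈ Ind then (b : ℝ) else 0) := by
    intro r
    split_ifs with h
    · exact_mod_cast hall _ r.toList_length
    · rw [add_zero]
      exact_mod_cast hgood _ r.toList_length h
  have hcnt' : ((cnt m Ind : ℕ) : ℝ) * b ≤ 2 ^ m * c := by exact_mod_cast hcnt
  calc ∑ r : List.Vector Bool m, (τ r.toList : ℝ)
      ≤ ∑ r : List.Vector Bool m, ((a : ℝ) + (if r.toList ∈ Ind then (b : ℝ) else 0)) :=
        Finset.sum_le_sum fun r _ => key r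
    _ = 2 ^ m * a + (cnt m Ind : ℝ) * b := by
        rw [Finset.sum_add_distrib, Finset.sum_const, Finset.card_univ, card_vector,
          Fintype.card_bool, nsmul_eq_mul, Finset.sum_ite, Finset.sum_const_zero, add_zero,
          Finset.sum_const, nsmul_eq_mul, cnt_eq_card_filter Ind]
        push_cast
        ring
    _ ≤ 2 ^ m * a + 2 ^ m * c := by linarith
    _ = ((a + c : ℕ) : ℝ) * 2 ^ m := by push_cast; ring

/-! ### Amplified one-sided witnesses: all windows of the coin string -/

/-- **The window map** `coinWindowFn p : ⟨⟨x, r⟩, u⟩ ↦ ⟨x, (r.drop |u|) ↾ p(|x|)⟩` (pair projections,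
`dropSndFn X` to drop `|u|` coins, `truncSndFn p` to keep `p(|x|)` of the rest).
[Arora–Barak 2009, §7.4.1 (independent repetitions), §1.3] [folklore] -/
noncomputable def coinWindowFn (p : Polynomial ℕ) : List Bool → List Bool :=
  truncSndFn p ∘ pairFn (fstP ∘ fstP) (sndP ∘ dropSndFn X ∘ pairFn sndP (sndP ∘ fstP))

/-- Value of the window map. [folklore] -/
theorem coinWindowFn_apply (p : Polynomial ℕ) (x r u : List Bool) :
    coinWindowFn p (boolPair (boolPair x r) u) =
      boolPair x ((r.drop u.length).take (p.eval x.length)) := by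
  simp [coinWindowFn, truncSndFn_boolPair, dropSndFn_boolPair]

/-- The window map is polynomial time. [Arora–Barak 2009, Thm. 2.8 (proof: composition)] [folklore] -/
theorem coinWindowFn_mem_FP (p : Polynomial ℕ) : coinWindowFn p ∈ FP :=
  comp_mem_FP (truncSndFn_mem_FP p)
    (pairFn_mem_FP (comp_mem_FP fstP_mem_FP fstP_mem_FP)
      (comp_mem_FP sndP_mem_FP (comp_mem_FP (dropSndFn_mem_FP X)
        (pairFn_mem_FP sndP_mem_FP (comp_mem_FP sndP_mem_FP fstP_mem_FP)))))

/-- **The amplified witness language** of a one-sided test `L'` with coin length `p`: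
`⟨x, r⟩ ∈ ampWitness L' p` iff some window `(r.drop i) ↾ p(|x|)` of `r` (`i < |⟨x, r⟩|`) has the
exact length `p(|x|)` and `⟨x, window⟩ ∈ L'` — "repeat the test on fresh coins and accept if some
run accepts". [Arora–Barak 2009, §7.4.1; Gill 1977, Prop. 5.5(iii)] [folklore] -/
noncomputable def ampWitness (L' : Language Bool) (p : Polynomial ℕ) : Language Bool :=
  bexLang X (coinWindowFn p ⁻¹' (L' ⊓ LenEq p))

/-- **The amplified witness language is in `P`** (`bexLang_mem_P`, `preimage_mem_P`,
`inter_mem_P`, `LenEq_mem_P`). [Arora–Barak 2009, §1.3 and §7.4.1] [folklore] -/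
theorem ampWitness_mem_P {L' : Language Bool} (hL' : L' ∈ Classes.P) (p : Polynomial ℕ) :
    ampWitness L' p ∈ Classes.P :=
  bexLang_mem_P X (preimage_mem_P (inter_mem_P hL' (LenEq_mem_P p)) (coinWindowFn_mem_FP p))

/-- Membership of a pair in the amplified witness language. [folklore] -/
theorem boolPair_mem_ampWitness {L' : Language Bool} {p : Polynomial ℕ} {x r : List Bool} :
    boolPair x r ∈ ampWitness L' p ↔ ∃ i < (boolPair x r).length,
      boolPair x ((r.drop i).take (p.eval x.length)) ∈ L' ∧
        ((r.drop i).take (p.eval x.length)).length = p.eval x.length := by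
  change (∃ i < (X : Polynomial ℕ).eval (boolPair x r).length,
    coinWindowFn p (boolPair (boolPair x r) (List.replicate i true)) ∈ L' ⊓ LenEq p) ↔ _
  refine exists_congr fun i => ?_
  rw [eval_X, coinWindowFn_apply, List.length_replicate]
  refine and_congr_right fun _ => ?_
  change _ ∈ L' ∧ _ ∈ LenEq p ↔ _
  rw [boolPair_mem_LenEq]

/-- **No false positives survive amplification**: if no coin string of the exact length `p(|x|)`
is accepted by `L'`, then `⟨x, r⟩ ∉ ampWitness L' p`. [Gill 1977, Def. 5.4 (VPP)] [folklore] -/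
theorem not_mem_ampWitness_of_forall {L' : Language Bool} {p : Polynomial ℕ} {x r : List Bool}
    (h : ∀ y : List Bool, y.length = p.eval x.length → boolPair x y ∉ L') :
    boolPair x r ∉ ampWitness L' p := by
  rw [boolPair_mem_ampWitness]
  rintro ⟨i, -, hmem, hlen⟩
  exact h _ hlen hmem

/-- **Indecisive coin strings have all blocks rejecting**: if `|r| = K·p(|x|) + d` and
`⟨x, r⟩ ∉ ampWitness L' p`, then each of the `K` leading blocks of `r` of length `p(|x|)` is a
rejecting coin string. [Arora–Barak 2009, §7.4.1] [folklore] -/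
theorem mem_allBlocks_of_not_mem_ampWitness {L' : Language Bool} {p : Polynomial ℕ}
    {x r : List Bool} {K d : ℕ} (hr : r.length = K * p.eval x.length + d)
    (h : boolPair x r ∉ ampWitness L' p) :
    r ∈ AllBlocks (p.eval x.length) {v | boolPair x v ∈ L'}ᶜ K := by
  refine mem_allBlocks_of_forall K r fun j hj => ?_
  rw [Set.mem_compl_iff, Set.mem_setOf_eq]
  intro hmem
  apply h
  rw [boolPair_mem_ampWitness]
  have hj' : (j + 1) * p.eval x.length ≤ K * p.eval x.length :=
    Nat.mul_le_mul_right _ (Nat.succ_le_of_lt hj)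
  rw [Nat.succ_mul] at hj'
  refine ⟨j * p.eval x.length, ?_, hmem, ?_⟩
  · rw [length_boolPair]
    omega
  · rw [List.length_take, List.length_drop]
    omega

/-- **Counting the indecisive coin strings**: if `x` is accepted by `L'` with probability `≥ 1/2`
on coin strings of length `p(|x|)`, then
`2^K · #{r ∈ {0,1}^{K p(|x|) + d} | ⟨x, r⟩ ∉ ampWitness L' p} ≤ 2^{K p(|x|) + d}`.
[Arora–Barak 2009, §7.4.1 (error `2^{-K}` after `K` repetitions)] [folklore] -/
theorem two_pow_mul_cnt_not_mem_ampWitness_le {L' : Language Bool} {p : Polynomial ℕ}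
    {x : List Bool} (hx : 1 / 2 ≤ uniformProb (p.eval x.length) {v | boolPair x v ∈ L'})
    (K d : ℕ) :
    2 ^ K * cnt (K * p.eval x.length + d) {r | boolPair x r ∉ ampWitness L' p} ≤
      2 ^ (K * p.eval x.length + d) := by
  refine le_trans (Nat.mul_le_mul_left _ (cnt_mono fun r hr h => ?_))
    (two_pow_mul_cnt_allBlocks_le (two_mul_cnt_compl_le hx) K d)
  exact mem_allBlocks_of_not_mem_ampWitness hr h

/-! ### Stage A: the trials -/

/-- **Stage A** of the Las Vegas machine, as a string function: on `w = ⟨x, r⟩`, output `[1]` if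
the amplified `RP` witness `W₁` for `L` fires, else `[]` if the amplified `RP` witness `W₂` for `Lᶜ`
fires, else the tagged input `0x` (to be decided by exhaustive search).
[Gill 1977, Prop. 5.5(iii); Arora–Barak 2009, Thm. 7.8] [folklore] -/
noncomputable def stageA (W₁ W₂ : Language Bool) : List Bool → List Bool :=
  condFn W₁ (fun _ => [true]) (condFn W₂ (fun _ => []) (List.cons false ∘ fstP))

/-- Stage A is polynomial time for `W₁, W₂ ∈ P` (`condFn_mem_FP`). [Arora–Barak 2009, §1.3] [folklore] -/
theorem stageA_mem_FP {W₁ W₂ : Language Bool} (h₁ : W₁ ∈ Classes.P) (h₂ : W₂ ∈ Classes.P) :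
    stageA W₁ W₂ ∈ FP :=
  condFn_mem_FP h₁ (const_mem_FP _)
    (condFn_mem_FP h₂ (const_mem_FP _) (comp_mem_FP (cons_mem_FP false) fstP_mem_FP))

/-- Stage A on a decisive-yes input. [folklore] -/
theorem stageA_of_mem {W₁ W₂ : Language Bool} {w : List Bool} (h : w ∈ W₁) :
    stageA W₁ W₂ w = [true] :=
  condFn_of_mem _ _ h

/-- Stage A on a decisive-no input. [folklore] -/
theorem stageA_of_not_mem_of_mem {W₁ W₂ : Language Bool} {w : List Bool} (h₁ : w ∉ W₁)
    (h₂ : w ∈ W₂) : stageA W₁ W₂ w = [] := by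
  rw [stageA, condFn_of_not_mem _ _ h₁, condFn_of_mem _ _ h₂]

/-- Stage A on an indecisive input `⟨x, r⟩` is the tagged word `0x`. [folklore] -/
theorem stageA_of_not_mem {W₁ W₂ : Language Bool} {x r : List Bool} (h₁ : boolPair x r ∉ W₁)
    (h₂ : boolPair x r ∉ W₂) : stageA W₁ W₂ (boolPair x r) = false :: x := by
  rw [stageA, condFn_of_not_mem _ _ h₁, condFn_of_not_mem _ _ h₂, Function.comp_apply,
    fstP_boolPair]

/-- The output of stage A on `⟨x, r⟩` has length at most `|x| + 1`. [folklore] -/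
theorem length_stageA_le (W₁ W₂ : Language Bool) (x r : List Bool) :
    (stageA W₁ W₂ (boolPair x r)).length ≤ x.length + 1 := by
  by_cases h₁ : boolPair x r ∈ W₁
  · rw [stageA_of_mem h₁]; simp
  · by_cases h₂ : boolPair x r ∈ W₂
    · rw [stageA_of_not_mem_of_mem h₁ h₂]; simp
    · rw [stageA_of_not_mem h₁ h₂]; simp

/-- On a decisive input the output of stage A has length at most `1`. [folklore] -/
theorem length_stageA_le_one {W₁ W₂ : Language Bool} {w : List Bool} (h : ¬ (w ∉ W₁ ∧ w ∉ W₂)) :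
    (stageA W₁ W₂ w).length ≤ 1 := by
  by_cases h₁ : w ∈ W₁
  · rw [stageA_of_mem h₁]; simp
  · have h₂ : w ∈ W₂ := by
      by_contra h₂
      exact h ⟨h₁, h₂⟩
    rw [stageA_of_not_mem_of_mem h₁ h₂]; simp

/-! ### Stage B: the residual language decided by exhaustive search -/

/-- A classically chosen member of `L` (junk `[]` if `L = ∅`; only used when `L` is inhabited).
[folklore] -/
noncomputable def yesWord (L : Language Bool) : List Bool :=
  open scoped Classical in
  if h : ∃ w : List Bool, w ∈ L then h.choose else []

/-- A classically chosen non-member of `L` (junk `[]` if `L` is everything). [folklore] -/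
noncomputable def noWord (L : Language Bool) : List Bool :=
  open scoped Classical in
  if h : ∃ w : List Bool, w ∉ L then h.choose else []

/-- `yesWord L ∈ L` as soon as `L` is inhabited. [folklore] -/
theorem yesWord_mem {L : Language Bool} {x : List Bool} (hx : x ∈ L) : yesWord L ∈ L := by
  have h : ∃ w : List Bool, w ∈ L := ⟨x, hx⟩
  rw [yesWord, dif_pos h]
  exact h.choose_spec

/-- `noWord L ∉ L` as soon as `Lᶜ` is inhabited. [folklore] -/
theorem noWord_not_mem {L : Language Bool} {x : List Bool} (hx : x ∉ L) : noWord L ∉ L := by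
  have h : ∃ w : List Bool, w ∉ L := ⟨x, hx⟩
  rw [noWord, dif_pos h]
  exact h.choose_spec

/-- **The decoding map** of stage B: `[1] ↦ yesWord L`, `[] ↦ noWord L`, `0x ↦ x` (a `P`-guarded
conditional on "first symbol is `1`" and "empty", then `List.tail`). [Arora–Barak 2009, §1.3] [folklore] -/
noncomputable def decodeFn (L : Language Bool) : List Bool → List Bool :=
  condFn (HeadIs true) (fun _ => yesWord L) (condFn IsNil (fun _ => noWord L) List.tail)

/-- The decoding map is polynomial time. [Arora–Barak 2009, §1.3] [folklore] -/
theorem decodeFn_mem_FP (L : Language Bool) : decodeFn L ∈ FP :=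
  condFn_mem_FP (HeadIs_mem_P true) (const_mem_FP _)
    (condFn_mem_FP IsNil_mem_P (const_mem_FP _) tail_mem_FP)

/-- `decodeFn L [1] = yesWord L`. [folklore] -/
theorem decodeFn_true (L : Language Bool) : decodeFn L [true] = yesWord L :=
  condFn_of_mem _ _ (mem_HeadIs.2 rfl)

/-- `decodeFn L [] = noWord L`. [folklore] -/
theorem decodeFn_nil (L : Language Bool) : decodeFn L [] = noWord L := by
  rw [decodeFn, condFn_of_not_mem _ _ (fun h => by simpa using mem_HeadIs.1 h),
    condFn_of_mem _ _ (mem_IsNil.2 rfl)]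

/-- `decodeFn L (0x) = x`. [folklore] -/
theorem decodeFn_cons_false (L : Language Bool) (x : List Bool) :
    decodeFn L (false :: x) = x := by
  rw [decodeFn, condFn_of_not_mem _ _ (fun h => by simpa using mem_HeadIs.1 h),
    condFn_of_not_mem _ _ (fun h => by simpa using mem_IsNil.1 h), List.tail_cons]

/-- **The residual language** `decodeFn⁻¹(L)` handed to the exhaustive-search stage:
`0x ∈ residual L ↔ x ∈ L`, while `[1] ∈ residual L` (resp. `[] ∉ residual L`) as soon as `L`
(resp. `Lᶜ`) is inhabited. [Arora–Barak 2009, Claim 2.4 / §2.6.2 (exhaustive search)] [folklore] -/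
noncomputable def residual (L : Language Bool) : Language Bool :=
  decodeFn L ⁻¹' L

/-- **The residual language is in `EXP`** when `L ∈ EXP` (`preimage_mem_EXP_of_mem_FP`).
[Arora–Barak 2009, §2.6.2] [folklore] -/
theorem residual_mem_EXP {L : Language Bool} (hL : L ∈ EXP) : residual L ∈ EXP :=
  preimage_mem_EXP_of_mem_FP hL (decodeFn_mem_FP L)

/-- **Correctness of the two-stage machine**: if the amplified witnesses have no false positives
on `⟨x, r⟩` (`W₁` fires only for `x ∈ L`, `W₂` only for `x ∉ L`), then deciding the residual
language on the output of stage A gives `[x ∈ L]`. [Gill 1977, Prop. 5.5(iii); Arora–Barak 2009,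
Thm. 7.8] [folklore] -/
theorem boolIndicator_residual_stageA {L W₁ W₂ : Language Bool} {x r : List Bool}
    (h₁ : boolPair x r ∈ W₁ → x ∈ L) (h₂ : boolPair x r ∈ W₂ → x ∉ L) :
    (residual L).boolIndicator (stageA W₁ W₂ (boolPair x r)) = L.boolIndicator x := by
  have hind : ∀ w : List Bool, (residual L).boolIndicator w = L.boolIndicator (decodeFn L w) :=
    fun _ => rfl
  rw [hind]
  by_cases hw₁ : boolPair x r ∈ W₁
  · have hx := h₁ hw₁
    rw [stageA_of_mem hw₁, decodeFn_true, (Set.mem_iff_boolIndicator _ _).1 hx]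
    exact (Set.mem_iff_boolIndicator _ _).1 (yesWord_mem hx)
  · by_cases hw₂ : boolPair x r ∈ W₂
    · have hx := h₂ hw₂
      rw [stageA_of_not_mem_of_mem hw₁ hw₂, decodeFn_nil, (Set.notMem_iff_boolIndicator _ _).1 hx]
      exact (Set.notMem_iff_boolIndicator _ _).1 (noWord_not_mem hx)
    · rw [stageA_of_not_mem hw₁ hw₂, decodeFn_cons_false]

/-! ### The Las Vegas machine -/

/-- **A Las Vegas machine for `L ∈ RP ∩ coRP`** (the `→` direction of `mem_ZPP_iff_expectedTime`;
Gill 1977, Prop. 5.5(iii) [Rabin], "`L` is in `ZPP` iff both `L` and `L̄` are in `VPP`", with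
Def. 5.1(iii); Arora–Barak 2009, Thm. 7.8). From `L ∈ RP` (witness `L₁ ∈ P`, coins `p₁`) and
`Lᶜ ∈ RP` (`L₂`, `p₂`): the zero-error algorithm `A.run x r = [x ∈ L]` with the exactly polynomial
coin budget `q = K·(p₁ + p₂)`, `K(n) = q₃(n+1)`, is computed by the composite of the stage-A machine
(`K(n)` trials of both tests on the windows of `r`, polynomial time `p_A`) and the `2^{q₃(m)}`-time
decider of the residual language (`RP ⊆ NP ⊆ EXP`); its step bound is
`2^{q₃(|stageA ⟨x,r⟩|)} + p_A(|⟨x, r⟩|)`, which is `≤ p_A(2n+2+q(n)) + 2^{q₃(1)}` off the indecisive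
coin strings and exceeds this by `≤ 2^{K(n)}` on them; these number `≤ 2^{q(n)}/2^{K(n)}`, so the
mean is `≤ p_A(2n+2+q(n)) + 2^{q₃(1)} + 1`, a polynomial in `n`.
[cite: Gill1977, Prop. 5.5(iii) and Def. 5.1(iii)] -/
theorem expectedTime_of_mem_ZPP {L : Language Bool} (hL : L ∈ ZPP) :
    ∃ A : RandAlg (List Bool) Bool,
      (∃ p q : Polynomial ℕ,
        A.RunsInExpectedTime id encodeBool (fun x => ((p.eval x.length : ℕ) : ℝ)) ∧
        ∀ n, A.coinLen n = q.eval n) ∧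
      ∀ (x : List Bool) (r : List Bool), r.length = A.coinLen x.length →
        A.run x r = L.boolIndicator x := by
  have hRP : L ∈ RP := hL.1
  have hcoRP : Lᶜ ∈ RP := hL.2
  obtain ⟨L₁, hL₁, p₁, hrp₁⟩ := hRP
  obtain ⟨L₂, hL₂, p₂, hrp₂⟩ := hcoRP
  -- stage B: the exponential-time decider of the residual language
  have hEXP : L ∈ EXP := NP_subset_EXP_holds (RP_subset_NP_holds hL.1)
  obtain ⟨q₃, MB, hMB⟩ := exists_two_pow_eval_of_mem_EXP (residual_mem_EXP hEXP)
  have hMB' : ∀ w : List Bool,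
      MB.OutputsWithin w [(residual L).boolIndicator w] (2 ^ q₃.eval w.length) := fun w => hMB w
  -- stage A: the trials
  obtain ⟨pA, MA, hMA⟩ := stageA_mem_FP (ampWitness_mem_P hL₁ p₁) (ampWitness_mem_P hL₂ p₂)
  have hMA' : ∀ w : List Bool, MA.OutputsWithin w
      (stageA (ampWitness L₁ p₁) (ampWitness L₂ p₂) w) (pA.eval w.length) := fun w => hMA w
  -- no false positives
  have hW₁ : ∀ x r : List Bool, boolPair x r ∈ ampWitness L₁ p₁ → x ∈ L := by
    intro x r h
    by_contra hx
    exact not_mem_ampWitness_of_forall ((hrp₁ x).2 hx) h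
  have hW₂ : ∀ x r : List Bool, boolPair x r ∈ ampWitness L₂ p₂ → x ∉ L := by
    intro x r h hx
    exact not_mem_ampWitness_of_forall ((hrp₂ x).2 (fun h' => h' hx)) h
  -- parameters
  set K : Polynomial ℕ := q₃.comp (X + 1) with hK
  set q : Polynomial ℕ := K * (p₁ + p₂) with hq
  have hKn : ∀ n : ℕ, K.eval n = q₃.eval (n + 1) := fun n => by
    simp [hK, eval_comp]
  have hqn : ∀ n : ℕ, q.eval n = K.eval n * p₁.eval n + K.eval n * p₂.eval n := fun n => by
    rw [hq, eval_mul, eval_add, mul_add]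
  refine ⟨⟨fun x _ => L.boolIndicator x, fun n => q.eval n⟩,
    ⟨pA.comp (2 * X + 2 + q) + C (2 ^ q₃.eval 1 + 1), q, ⟨MA.comp MB,
      fun x r => 2 ^ q₃.eval (stageA (ampWitness L₁ p₁) (ampWitness L₂ p₂) (boolPair x r)).length +
        pA.eval (boolPair x r).length, fun x r _ => ?_, fun x => ?_⟩, fun n => rfl⟩,
    fun x r _ => rfl⟩
  · -- the composite machine answers `[x ∈ L]`
    have h := TM2ComputableAux.comp_outputsWithin MA MB (hMA' (boolPair x r))
      (hMB' (stageA (ampWitness L₁ p₁) (ampWitness L₂ p₂) (boolPair x r)))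
    rw [boolIndicator_residual_stageA (hW₁ x r) (hW₂ x r)] at h
    exact h
  · -- the mean of the step bound
    set n := x.length with hn
    change (∑ r : List.Vector Bool (q.eval n), ((2 ^ q₃.eval (stageA (ampWitness L₁ p₁)
        (ampWitness L₂ p₂) (boolPair x r.toList)).length + pA.eval (boolPair x r.toList).length
          : ℕ) : ℝ)) / 2 ^ (q.eval n) ≤
      (((pA.comp (2 * X + 2 + q) + C (2 ^ q₃.eval 1 + 1)).eval n : ℕ) : ℝ)
    have heval : (pA.comp (2 * X + 2 + q) + C (2 ^ q₃.eval 1 + 1)).eval n =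
        (pA.eval (2 * n + 2 + q.eval n) + 2 ^ q₃.eval 1) + 1 := by
      simp only [eval_add, eval_comp, eval_mul, eval_ofNat, eval_X, eval_C]
      ring
    rw [heval]
    refine mean_le_of_split (fun r => 2 ^ q₃.eval (stageA (ampWitness L₁ p₁) (ampWitness L₂ p₂)
        (boolPair x r)).length + pA.eval (boolPair x r).length)
      {r | boolPair x r ∉ ampWitness L₁ p₁ ∧ boolPair x r ∉ ampWitness L₂ p₂}
      (pA.eval (2 * n + 2 + q.eval n) + 2 ^ q₃.eval 1) (2 ^ K.eval n) 1
      (fun r hr => ?_) (fun r hr hgood => ?_) ?_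
    · -- every coin string: `|stageA ⟨x, r⟩| ≤ n + 1`
      have h1 : 2 ^ q₃.eval (stageA (ampWitness L₁ p₁) (ampWitness L₂ p₂) (boolPair x r)).length ≤
          2 ^ K.eval n := by
        rw [hKn]
        exact Nat.pow_le_pow_right Nat.two_pos (TM2Iter.eval_mono q₃ (length_stageA_le _ _ x r))
      have h2 : pA.eval (boolPair x r).length = pA.eval (2 * n + 2 + q.eval n) := by
        rw [length_boolPair, hr]
      rw [h2]
      calc _ ≤ 2 ^ K.eval n + pA.eval (2 * n + 2 + q.eval n) := Nat.add_le_add_right h1 _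
        _ = pA.eval (2 * n + 2 + q.eval n) + 2 ^ K.eval n := Nat.add_comm _ _
        _ ≤ pA.eval (2 * n + 2 + q.eval n) + 2 ^ q₃.eval 1 + 2 ^ K.eval n :=
          Nat.add_le_add_right (Nat.le_add_right _ _) _
    · -- decisive coin strings: `|stageA ⟨x, r⟩| ≤ 1`
      have h1 : 2 ^ q₃.eval (stageA (ampWitness L₁ p₁) (ampWitness L₂ p₂) (boolPair x r)).length ≤
          2 ^ q₃.eval 1 :=
        Nat.pow_le_pow_right Nat.two_pos (TM2Iter.eval_mono q₃ (length_stageA_le_one hgood))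
      have h2 : pA.eval (boolPair x r).length = pA.eval (2 * n + 2 + q.eval n) := by
        rw [length_boolPair, hr]
      rw [h2, Nat.add_comm]
      exact Nat.add_le_add_left h1 _
    · -- the indecisive coin strings number `≤ 2^{q(n)}/2^{K(n)}`
      rw [mul_one, mul_comm]
      by_cases hx : x ∈ L
      · have hcnt := two_pow_mul_cnt_not_mem_ampWitness_le ((hrp₁ x).1 hx) (K.eval n)
          (K.eval n * p₂.eval n)
        rw [← hqn] at hcnt
        exact le_trans (Nat.mul_le_mul_left _ (cnt_mono fun r _ h => h.1)) hcnt
      · have hx' : x ∈ Lᶜ := hx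
        have hcnt := two_pow_mul_cnt_not_mem_ampWitness_le ((hrp₂ x).1 hx') (K.eval n)
          (K.eval n * p₁.eval n)
        rw [show K.eval n * p₂.eval n + K.eval n * p₁.eval n = q.eval n by rw [hqn, add_comm]]
          at hcnt
        exact le_trans (Nat.mul_le_mul_left _ (cnt_mono fun r _ h => h.2)) hcnt

end ZPPExpected

open ZPPExpected

/-- **Discharge of `mem_ZPP_iff_expectedTime`** (`ProbabilisticClasses.lean`): `L ∈ ZPP = RP ∩ coRP`
iff some zero-error randomized algorithm with an exactly polynomial coin budget decides `L` on
every coin string and runs in expected polynomial time — Gill 1977, Def. 5.1(iii) (`ZPP` by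
"polynomial bounded average run time and zero error probability") with Prop. 5.5(iii) [Rabin]
("`L` is in `ZPP` iff both `L` and `L̄` are in `VPP`"); Arora–Barak 2009, Def. 7.7 and Thm. 7.8.
`→` is `ZPPExpected.expectedTime_of_mem_ZPP` (amplified trials, exhaustive search on the rare
indecisive coin strings); `←` is `mem_ZPP_of_expectedTime_of_clockedUniversalAcceptance`
(`ZPPOfExpectedTime.lean`: truncation at twice the mean, Markov) fed with the discharged clocked
universal acceptance test `clockedUniversalAcceptance_holds`.
[cite: Gill1977, Def. 5.1(iii) and Prop. 5.5(iii)] -/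
theorem mem_ZPP_iff_expectedTime_holds : mem_ZPP_iff_expectedTime := by
  intro L
  exact ⟨expectedTime_of_mem_ZPP, fun ⟨A, hA, hzero⟩ =>
    mem_ZPP_of_expectedTime_of_clockedUniversalAcceptance clockedUniversalAcceptance_holds A hA
      hzero⟩

end Literature.Computability.Complexity
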